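import Summits.KontsevichZagierPeriods.Zeta5Search.RVLargeParamZCoverBonus
import Summits.KontsevichZagierPeriods.Zeta5Search.RVLargeParamHighIneq
import Summits.KontsevichZagierPeriods.Zeta5Search.ZeroEvaluationProof
import HarnessLib

/-!
# RVLargeParamZCoverHigh — the high band of the bonus regime is PROVED (fam-rv gen 9, file 10; #9.6b)

HONEST FRAMING: systematic search; no irrationality claim unless certified.  PROOF of the node `LargeParamHighBandPos` of file 8
(`RVLargeParamZCoverBonus.lean`): in the large-parameter regime (polytope, designated slot `i`, all other blocks short), if
`lpBonus(b,p) ≥ 1` and `t := −N_p(b) + lpBonus(b,p) ≥ −3`, then BOTH `b` and `b + e_j` pass the counting test at `t`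
(`largeParamHighBandPos_holds`).  Steps:
* SHAPE (file 9, `highBand_shape`, `lp_partner`): `lpBonus = 1`, `N_p ≤ 4`, the designated block is long and there is an LP partner
  `k ≠ i` (`b_k ≥ p`, `b₀ − b_i − b_k ≥ p`); so `t = 1 − N_p` and `N_p ≥ 1`.
* CLASS BOUND (`classNu_ge_one_sub_of_lp`): every pole class has `ν_x ≥ 1 − N_p`.  A tame class has `ν_x ≥ 0`.  A wild class has one
  pole `q ≥ b_i + p` (a non-positive class point lies below it, inside the long block); the `depth(q) − 1` short blocks through `q`
  each give a unit pair floor with `i`, so `N_p ≥ depth(q) − 1` and `E_x ≥ netExp(q) ≥ −N_p`; the missing unit: EITHER some block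
  off `q` also gives a unit (then `N_p ≥ depth(q)`), OR all blocks off `q` are unit-free — then the partner block passes through `q`
  (`q + p ≤ b₀`), a unit-free short block `j₀` exists (`depth(q) − 1 ≤ N_p ≤ 4 < 6`) and forces `b₀ ≤ 2b_i + 2p − 2 < (q + p) + b_i`,
  so the class point `q + p` lies in NO block: a zero, `E_x ≥ netExp(q) + 1 ≥ 1 − N_p`.
* SHIFT (`countingCase_shift_of`): `ν_x(b + e_j) ≥ ν_x(b)` and poles of `b + e_j` are poles of `b` (typer g8,
  `CasoratianClassBoundShift.lean`), so the counting test passes from `b` to `b + e_j` at any exponent.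
Consequences: `LargeParamHighBandCounting` (file 7) holds; the cover `LargeParamZCover`, the floor `LargeParamVFloor`, the class law
`LargeParamClassLaw` and `FlatGaugeLawF1` all follow from the ONE remaining node `LargeParamZCoverMidPos` (file 8: the pairs with
`lpBonus ≥ 1` and `t ∈ {−5, −4}`) — `largeParamZCover_of_midPos`, `largeParamClassLaw_of_midPos`, `flatGaugeLawF1_of_midPos`.
Block combinatorics and `p`-adic bookkeeping only; nothing about irrationality.
-/

noncomputable section

open Finset

namespace Summit.KontsevichZagierPeriods.Zeta5Search.ClusterValuation

open Summit.KontsevichZagierPeriods.Zeta5Search.DualSeries (InBox)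
open Summit.KontsevichZagierPeriods.Zeta5Search.CasoratianValuation (InPolytope pairFloors shift)
open Summit.KontsevichZagierPeriods.Zeta5Search.RVFlatGauge (countingCase)
open Summit.KontsevichZagierPeriods.Zeta5Search.RVFlatGauge.Cap (lpUnit lpBonus)

variable {p : ℕ}

/-! ### Single-pole classes: the other points are non-negative (tree: `netExp_nonneg_of_unique_pole`) -/

/-- `E_x ≥ netExp(q)` for the pole `q` of a single-pole class. -/
theorem classExp_ge_pole (b : ℕ → ℤ) {x q : ℕ} (h1 : classPoleCount b p x = 1) (hq : q ∈ classSet b p x)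
    (hqp : netExp b q < 0) : netExp b q ≤ classExp b p x := by
  unfold classExp
  rw [← add_sum_erase _ _ hq]
  have h0 : 0 ≤ ∑ s ∈ (classSet b p x).erase q, netExp b s :=
    sum_nonneg fun s hs => netExp_nonneg_of_unique_pole b h1 hq hqp (mem_of_mem_erase hs) (mem_erase.1 hs).1
  have hc : (0 : ℤ) ≤ (if ¬ (2 : ℤ) ∣ b 0 ∧ CentreIn b p x then 1 else 0) := by split_ifs <;> norm_num
  linarith

/-- `E_x ≥ netExp(q) + netExp(s)` for the pole `q` and any other point `s` of a single-pole class. -/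
theorem classExp_ge_pole_add (b : ℕ → ℤ) {x q s : ℕ} (h1 : classPoleCount b p x = 1) (hq : q ∈ classSet b p x)
    (hqp : netExp b q < 0) (hs : s ∈ classSet b p x) (hsq : s ≠ q) : netExp b q + netExp b s ≤ classExp b p x := by
  unfold classExp
  have hs' : s ∈ (classSet b p x).erase q := mem_erase.2 ⟨hsq, hs⟩
  rw [← add_sum_erase _ _ hq, ← add_sum_erase _ _ hs']
  have h0 : 0 ≤ ∑ u ∈ ((classSet b p x).erase q).erase s, netExp b u :=
    sum_nonneg fun u hu => netExp_nonneg_of_unique_pole b h1 hq hqp (mem_of_mem_erase (mem_of_mem_erase hu))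
      (mem_erase.1 (mem_of_mem_erase hu)).1
  have hc : (0 : ℤ) ≤ (if ¬ (2 : ℤ) ∣ b 0 ∧ CentreIn b p x then 1 else 0) := by split_ifs <;> norm_num
  linarith

/-! ### The high-band class bound -/

/-- **THE HIGH-BAND CLASS BOUND:** a long designated block `i`, short blocks elsewhere, an LP partner `k` and `N_p ≤ 4`: every pole
class has `ν_x ≥ 1 − N_p`. -/
theorem classNu_ge_one_sub_of_lp (b : ℕ → ℤ) (hb : InPolytope b) (hp : 0 < p) {i k : ℕ} (hi : i ∈ range 7)
    (hk : k ∈ (range 7).erase i) (hshort : ∀ k ∈ (range 7).erase i, b 0 - 2 * b (k + 1) < p)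
    (hlong : (p : ℤ) ≤ b 0 - 2 * b (i + 1)) (hβk : (p : ℤ) ≤ b (k + 1)) (hAk : (p : ℤ) ≤ b 0 - b (i + 1) - b (k + 1))
    (hN4 : pairFloors b p ≤ 4) {x : ℕ} (hpole : 1 ≤ classPoleCount b p x) : 1 - pairFloors b p ≤ classNu b p x := by
  have hbox : InBox b := hb.1
  have h1 : classPoleCount b p x = 1 := le_antisymm (classPoleCount_le_one_of_short_blocks b hb hp hshort x) hpole
  have hN1 : (1 : ℤ) ≤ pairFloors b p := by
    have h := card_le_pairFloors_of_units b hb hp hi (S := {k}) (singleton_subset_iff.2 hk) (by simpa using hAk)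
    simpa using h
  unfold classNu
  split_ifs with htame
  · exact le_trans (by linarith) (le_max_right _ _)
  -- the class is wild: its pole `q` has `q ≥ p` and a non-positive class point `s < q`
  obtain ⟨q, hq⟩ := card_pos.1 (by unfold classPoleCount at hpole; omega :
    0 < ((classSet b p x).filter fun s => netExp b s < 0).card)
  rw [mem_filter] at hq
  have hw : ¬ (q < p ∨ ∀ s ∈ classSet b p x, s < q → 0 < netExp b s) := by
    intro hor
    apply htame
    refine ⟨h1, ?_⟩
    unfold tameSingle
    exact decide_eq_true ⟨q, hq.1, hq.2, hor⟩
  push Not at hw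
  obtain ⟨_, s, hs, hsq, hs0⟩ := hw
  -- `i` carries the least parameter: `s` and `q` lie in the block `B_i`
  have hmin : ∀ j ∈ range 7, b (i + 1) ≤ b (j + 1) := by
    intro j hj
    by_cases hji : j = i
    · rw [hji]
    · have := hshort j (mem_erase.2 ⟨hji, hj⟩); omega
  have hsblk : s ∈ blk b i :=
    mem_largest_of_blockCount b hbox hi hmin (by unfold netExp at hs0; split_ifs at hs0 <;> omega)
  have hq2 := two_le_blockCount_of_pole b hq.2
  have hqi : q ∈ blk b i := mem_largest_of_blockCount b hbox hi hmin (by omega)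
  have h0 : 0 ≤ b 0 := hbox.1
  have hβi0 : 0 ≤ b (i + 1) := (hbox.2 i hi).1
  have e0 : (((b 0).toNat : ℕ) : ℤ) = b 0 := Int.toNat_of_nonneg h0
  have ei : (((b (i + 1)).toNat : ℕ) : ℤ) = b (i + 1) := Int.toNat_of_nonneg hβi0
  have hsβ := ((mem_blk b i s).1 hsblk).1
  -- `q ≥ s + p`
  have hqs : s + p ≤ q := by
    obtain ⟨m, hm⟩ := dvd_sub_of_mem_classSet b hq.1 hs
    have hm1 : 1 ≤ m := by
      by_contra hm'
      push Not at hm'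
      have : (p : ℤ) * m ≤ (p : ℤ) * 0 := mul_le_mul_of_nonneg_left (by omega) (by omega)
      omega
    have : (p : ℤ) * 1 ≤ (p : ℤ) * m := mul_le_mul_of_nonneg_left hm1 (by omega)
    omega
  -- the short blocks through `q`: each gives a unit pair floor with `i`
  set T := ((range 7).erase i).filter (fun j => q ∈ blk b j) with hT
  have hTsub : T ⊆ (range 7).erase i := filter_subset _ _
  have hTunit : ∀ j ∈ T, (p : ℤ) ≤ b 0 - b (i + 1) - b (j + 1) := by
    intro j hj
    obtain ⟨hj', hqj⟩ := mem_filter.1 hj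
    have hj7 := mem_range.1 (mem_erase.1 hj').2
    have hβj0 : 0 ≤ b (j + 1) := (hbox.2 j (mem_range.2 hj7)).1
    have ej : (((b (j + 1)).toNat : ℕ) : ℤ) = b (j + 1) := Int.toNat_of_nonneg hβj0
    have hqj' := ((mem_blk b j q).1 hqj).2
    have hβjle : 2 * b (j + 1) ≤ b 0 := hb.2.1 j (mem_range.2 hj7)
    omega
  have hTcount : (T.card : ℤ) + 1 = blockCount b q := by
    have hTe : T = ((range 7).filter fun j => q ∈ blk b j).erase i := by
      ext j; simp only [hT, mem_filter, mem_erase]; tauto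
    have hmem : i ∈ (range 7).filter fun j => q ∈ blk b j := mem_filter.2 ⟨hi, hqi⟩
    have h1c : 1 ≤ ((range 7).filter fun j => q ∈ blk b j).card := card_pos.2 ⟨i, hmem⟩
    rw [hTe, card_erase_of_mem hmem, blockCount_eq]
    omega
  have hTN : (T.card : ℤ) ≤ pairFloors b p := card_le_pairFloors_of_units b hb hp hi hTsub hTunit
  have hnetq : 1 - (blockCount b q : ℤ) ≤ netExp b q := by unfold netExp; split_ifs <;> omega
  have hEq := classExp_ge_pole b h1 hq.1 hq.2
  -- case A: some block off `q` and off `i` still gives a unit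
  by_cases hA : ∃ j ∈ (range 7).erase i, j ∉ T ∧ (p : ℤ) ≤ b 0 - b (i + 1) - b (j + 1)
  · obtain ⟨j, hj, hjT, hju⟩ := hA
    have hTN' : ((insert j T).card : ℤ) ≤ pairFloors b p :=
      card_le_pairFloors_of_units b hb hp hi (insert_subset hj hTsub) fun j' hj' => by
        rcases mem_insert.1 hj' with e | h
        · rw [e]; exact hju
        · exact hTunit j' h
    have hlt : T.card < (insert j T).card := card_lt_card (ssubset_insert hjT)
    have : (T.card : ℤ) + 1 ≤ pairFloors b p := by
      have : ((T.card : ℕ) : ℤ) + 1 ≤ ((insert j T).card : ℤ) := by exact_mod_cast hlt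
      linarith
    linarith
  -- case B: every block off `T ∪ {i}` is unit-free
  push Not at hA
  have hkT : k ∈ T := by
    by_contra hkT
    have := hA k hk hkT
    omega
  obtain ⟨j₀, hj₀, hj₀T⟩ : ∃ j₀ ∈ (range 7).erase i, j₀ ∉ T := by
    by_contra hnone
    push Not at hnone
    have hle : ((range 7).erase i).card ≤ T.card := card_le_card fun j hj => hnone j hj
    rw [card_erase_of_mem hi, card_range] at hle
    have : (T.card : ℤ) ≤ 4 := hTN.trans hN4
    omega
  have hj₀lt := hA j₀ hj₀ hj₀T
  have hj₀7 := mem_range.1 (mem_erase.1 hj₀).2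
  have hj₀half : 2 * b (j₀ + 1) ≤ b 0 := hb.2.1 j₀ (mem_range.2 hj₀7)
  -- `k ∈ T`: `q ≤ b₀ − b_k ≤ b₀ − p`, so `q + p` is a point of the class
  have hk7 := mem_range.1 (mem_erase.1 hk).2
  have hβk0 : 0 ≤ b (k + 1) := (hbox.2 k (mem_range.2 hk7)).1
  have ek : (((b (k + 1)).toNat : ℕ) : ℤ) = b (k + 1) := Int.toNat_of_nonneg hβk0
  have hqk := ((mem_blk b k q).1 (mem_filter.1 hkT).2).2
  have hmem : q + p ∈ classSet b p x := by
    have hqx : q % p = x % p := (mem_filter.1 hq.1).2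
    refine mem_filter.2 ⟨mem_range.2 (by omega), ?_⟩
    rw [Nat.add_mod_right]
    exact hqx
  -- and it lies above `b₀ − b_i`, hence in no block: a zero of the class
  have hzero : blockCount b (q + p) = 0 := by
    rw [blockCount_eq, card_eq_zero, filter_eq_empty_iff]
    intro j hj hqpj
    have hsub := blk_subset_blk b hbox (mem_range.1 hi) (mem_range.1 hj) (hmin j hj) hqpj
    have := ((mem_blk b i (q + p)).1 hsub).2
    omega
  have hnet1 : 1 ≤ netExp b (q + p) := by unfold netExp; rw [hzero]; split_ifs <;> norm_num
  have hne : q + p ≠ q := by omega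
  have := classExp_ge_pole_add b h1 hq.1 hq.2 hmem hne
  linarith

/-! ### The counting test under the shift -/

/-- **The counting test passes from `b` to `b + e_j`** at any exponent (`ν_x` rises, poles persist downward). -/
theorem countingCase_shift_of (b : ℕ → ℤ) (hbox : InBox b) {j : ℕ} (hj1 : 1 ≤ j) {t : ℤ}
    (h : countingCase b p t = true) : countingCase (shift b j) p t = true := by
  unfold countingCase at h ⊢
  have h' := of_decide_eq_true h
  exact decide_eq_true fun x hx hpole =>
    (h' x hx (hpole.trans (classPoleCount_shift_le b hbox hj1 p x))).trans (classNu_shift_ge b hbox hj1 hpole)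

/-- **HIGH BAND, BOTH CONSTANT TERMS:** in the regime, `1 ≤ lpBonus` and `−3 ≤ −N_p + lpBonus` make `b` and `b + e_j` pass the
counting test at `−N_p + lpBonus`. -/
theorem highBand_countingPair (b : ℕ → ℤ) {j i : ℕ} (hb : InPolytope b) (hj1 : 1 ≤ j) (hp : 0 < p)
    (hshort : ∀ k ∈ (range 7).erase i, b 0 - 2 * b (k + 1) < p) (h1 : 1 ≤ lpBonus b p)
    (ht : -3 ≤ -pairFloors b p + lpBonus b p) :
    countingCase b p (-pairFloors b p + lpBonus b p) = true ∧
      countingCase (shift b j) p (-pairFloors b p + lpBonus b p) = true := by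
  -- a designated slot inside `range 7`
  obtain ⟨i₀, hi₀, hshort₀⟩ : ∃ i₀ ∈ range 7, ∀ k ∈ (range 7).erase i₀, b 0 - 2 * b (k + 1) < p := by
    by_cases hi : i ∈ range 7
    · exact ⟨i, hi, hshort⟩
    · refine ⟨0, by simp, fun k hk => hshort k (mem_erase.2 ⟨?_, (mem_erase.1 hk).2⟩)⟩
      rintro rfl
      exact hi (mem_erase.1 hk).2
  obtain ⟨hone, hN4, hlp⟩ := highBand_shape b hb hp hi₀ hshort₀ h1 ht
  obtain ⟨hlong, k, hk, hβk, hAk⟩ := lp_partner b hshort₀ hlp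
  have hb_part : countingCase b p (-pairFloors b p + lpBonus b p) = true := by
    unfold countingCase
    refine decide_eq_true fun x hx hpole => ?_
    rw [hone]
    have := classNu_ge_one_sub_of_lp b hb hp hi₀ hk hshort₀ hlong hβk hAk hN4 hpole
    linarith
  exact ⟨hb_part, countingCase_shift_of b hb.1 hj1 hb_part⟩

end Summit.KontsevichZagierPeriods.Zeta5Search.ClusterValuation

/-! ### The node `LargeParamHighBandPos` and its consequences -/

namespace Summit.KontsevichZagierPeriods.Zeta5Search.RVFlatGauge

open Summit.KontsevichZagierPeriods.Zeta5Search.ClusterValuation (highBand_countingPair)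

/-- **`LargeParamHighBandPos` HOLDS (PROVED).** -/
theorem largeParamHighBandPos_holds : LargeParamHighBandPos :=
  fun b _ _ _ hb hj1 _ _ hpr _ _ hshort h1 ht => highBand_countingPair b hb hj1 hpr.pos hshort h1 ht

/-- Hence the file-7 node `LargeParamHighBandCounting` holds. -/
theorem largeParamHighBandCounting_holds : LargeParamHighBandCounting :=
  largeParamHighBand_of_pos largeParamHighBandPos_holds

/-- **The cover `LargeParamZCover` follows from the mid band alone.** -/
theorem largeParamZCover_of_midPos (hM : LargeParamZCoverMidPos) : LargeParamZCover :=
  largeParamZCover_of_posBands hM largeParamHighBandPos_holds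

/-- Hence (V⁺) `LargeParamVFloor` from the mid band alone. -/
theorem largeParamVFloor_of_midPos (hM : LargeParamZCoverMidPos) : LargeParamVFloor :=
  largeParamVFloor_of_zCover (largeParamZCover_of_midPos hM)

/-- Hence the class law (CV⁺) `LargeParamClassLaw` from the mid band alone. -/
theorem largeParamClassLaw_of_midPos (hM : LargeParamZCoverMidPos) : LargeParamClassLaw :=
  largeParamClassLaw_of_zCover (largeParamZCover_of_midPos hM)

/-- Hence `FlatGaugeLawF1` from the mid band alone. -/
theorem flatGaugeLawF1_of_midPos (hM : LargeParamZCoverMidPos) : FlatGaugeLawF1 :=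
  flatGaugeLawF1_of_zCover (largeParamZCover_of_midPos hM)

end Summit.KontsevichZagierPeriods.Zeta5Search.RVFlatGauge

end
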